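import Summits.Parity.GeneralizedHardyLittlewood.Theorems.LiouvilleShiftedTablesDefs
import Summits.Parity.GeneralizedHardyLittlewood.Theorems.LiouvilleShiftedTablesTypeI2DilatedWindowTools
import Summits.Parity.GeneralizedHardyLittlewood.Theorems.LiouvilleShiftedTablesTypeI2DilatedWindowNumerics
import Literature.NumberTheory.Sieve.LogWindowSeparation
import Literature.NumberTheory.Sieve.DivisorBound

/-!
# Type I₂ dilated, line `peel-to-drappeau`: THE WINDOW step (`stub_window : WindowStep`)

`WindowStep : DilatedTypeIICore → DilatedTypeII` (crux `TypeI2Dilated`, route `LiouvilleShiftedTables`,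
registered stub `stub_window` of stmt-Parity-14272; vocabulary in `…Theorems.LiouvilleShiftedTablesDefs`):
the sharp hyperbolic window `Ylo < mn ≤ Yhi` is separated multiplicatively by archimedean characters
(`Literature.NumberTheory.Sieve.LogWindow`, Fejér smoothing in `log k` at logarithmic cost), the
twisted coefficients `α_m m^{iτ}`, `β_n n^{iτ}` keep their divisor bounds so `DilatedTypeIICore` applies
uniformly in `τ`, and the two strips and the far error are bounded trivially (`…WindowTools`,
`…WindowNumerics`).  [this line: peel-to-drappeau]
-/

noncomputable section

namespace Summit.Parity.GeneralizedHardyLittlewood.Cruxes.TypeI2Dilated.PeelToDrappeau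

open Finset Real
open scoped ArithmeticFunction.sigma Classical
open Literature.NumberTheory.Sieve Literature.NumberTheory.Sieve.Drappeau2017
  Literature.NumberTheory.Sieve.FouvryTenenbaum2021
open Summit.Parity.GeneralizedHardyLittlewood.Theses.LiouvilleShiftedTables (TypeI2Dilated BVLiouville)

/-- STUB — THE WINDOW (`DilatedTypeIICore → DilatedTypeII`): separation of the hyperbolic window
`Ylo < mn ≤ Yhi` by the archimedean characters `(mn)^{iτ} = m^{iτ} n^{iτ}`
(`LogWindow.sum_sum_norm_windowed_le`, at logarithmic cost absorbed by `x^ρ`), the twisted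
coefficients keeping their divisor bounds so that `DilatedTypeIICore` applies uniformly, and the
strips/tails bounded trivially through `|𝔲_R(t; s)| ≤ 1_{s ∣ k−c} + Rd τ(s)²/s`
(`sum_norm_uR_le`) and the divisor bound. [this line] -/
theorem stub_window : WindowStep := by
  intro hCore c hc η hη hη12
  obtain ⟨ρ₀, hρ₀, hcore⟩ := hCore c hc η hη hη12
  -- shrink `ρ₀` to `ρ₁ = min ρ₀ (η / 4)` (all hypotheses of the conclusion only get stronger)
  obtain ⟨ρ₁, hρ₁def⟩ : ∃ ρ₁ : ℝ, ρ₁ = min ρ₀ (η / 4) := ⟨_, rfl⟩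
  have hρ₁pos : 0 < ρ₁ := by rw [hρ₁def]; exact lt_min hρ₀ (by positivity)
  have hρ₁ρ₀ : ρ₁ ≤ ρ₀ := by rw [hρ₁def]; exact min_le_left _ _
  have hρ₁η : 4 * ρ₁ ≤ η := by
    have : ρ₁ ≤ η / 4 := by rw [hρ₁def]; exact min_le_right _ _
    linarith
  have hρ₁s : ρ₁ ≤ 1 / 48 := by linarith
  refine ⟨ρ₁, hρ₁pos, ?_⟩
  intro ρ hρ hρρ₁ K hK
  obtain ⟨C₁, x₁, h₁⟩ := hcore ρ hρ (hρρ₁.trans hρ₁ρ₀) K hK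
  -- divisor bounds at the exponent `ε = ρ₁ / 4`
  obtain ⟨ε, hεdef⟩ : ∃ ε : ℝ, ε = ρ₁ / 4 := ⟨_, rfl⟩
  have hε : 0 < ε := by rw [hεdef]; positivity
  obtain ⟨Cd, hCd1, hCd⟩ := Literature.NumberTheory.Sieve.exists_card_divisors_le_mul_rpow' hε
  obtain ⟨Ca, hCa1, hCa⟩ :=
    Literature.NumberTheory.Sieve.exists_sigma_zero_le_mul_rpow (ε := ε / (K + 1)) (by positivity)
  -- the constants
  obtain ⟨C₁', hC₁'⟩ : ∃ C₁' : ℝ, C₁' = max C₁ 0 := ⟨_, rfl⟩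
  have hC₁'0 : 0 ≤ C₁' := by rw [hC₁']; exact le_max_right _ _
  have hC₁C₁' : C₁ ≤ C₁' := by rw [hC₁']; exact le_max_left _ _
  obtain ⟨Kc, hKc⟩ : ∃ Kc : ℝ, Kc = 3 * 1025 * 83456 * (Ca ^ K) ^ 2 * Cd ^ 2 := ⟨_, rfl⟩
  have hKc0 : 0 ≤ Kc := by rw [hKc]; positivity
  obtain ⟨x₀, hx₀⟩ := Filter.eventually_atTop.mp
    (window_eventually x₁ c hρ hρ₁pos (by linarith))
  refine ⟨C₁' + Kc, x₀, ?_⟩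
  intro x hx M N hN hN' hMN hMN' α β hα hβ u v Ylo Yhi R Slo Rd hR hSlo hSloR hRd1 hRdx
  obtain ⟨hxx₁, hx1024, hxc, hxc', hlogρ, hlog4, hlog1, hlog0⟩ := hx₀ x hx
  -- basic sizes
  have hx1 : (1 : ℝ) < x := by linarith
  have hx0 : (0 : ℝ) < x := by linarith
  have hxρ0 : 0 ≤ x ^ ρ := Real.rpow_nonneg hx0.le _
  have hRd0 : 0 < Rd := by linarith
  have hRHS0 : 0 ≤ (C₁' + Kc) * x ^ (1 + 5 * ρ) / Rd := by positivity
  -- degenerate case `R < 1`: no `r`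
  rcases lt_or_ge R 1 with hR1 | hR1
  · have hRs : Icc 1 ⌊R⌋₊ = ∅ := by
      rw [Nat.floor_eq_zero.mpr hR1]; rfl
    simp only [hRs, sum_empty, sum_const_zero]
    exact hRHS0
  -- sizes of the boxes
  have hN1 : (1 : ℝ) ≤ N := le_trans (Real.one_le_rpow hx1.le hη.le) hN
  have hN0 : (0 : ℝ) < N := by linarith
  obtain ⟨P, hP⟩ : ∃ P : ℝ, P = M * N := ⟨_, rfl⟩
  have hPlo : x ^ (1 - ρ₁) ≤ P := by rw [hP]; exact hMN
  have hPhi : P ≤ 256 * x := by rw [hP]; exact hMN'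
  have hP2 : 2 * (|(c : ℝ)| + 1) ≤ P := hxc.trans hPlo
  have hc0 : (0 : ℝ) ≤ |(c : ℝ)| := abs_nonneg _
  have hP1 : (2 : ℝ) ≤ P := by linarith
  have hM : M = P / N := by rw [hP]; field_simp
  have hM1 : (1 : ℝ) ≤ M := by
    -- `M = P/N ≥ x^{1-ρ₁} / x^{1/3-η} ≥ 1`
    rw [hM, le_div_iff₀ hN0, one_mul]
    refine hN'.trans (le_trans ?_ hPlo)
    exact Real.rpow_le_rpow_of_exponent_le hx1.le (by linarith)
  have hM0 : (0 : ℝ) < M := by linarith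
  have hMx : M ≤ 256 * x := by
    rw [hM, div_le_iff₀ hN0]; nlinarith
  have hMη : M ≤ 256 * x ^ (1 - η) := by
    rw [hM, div_le_iff₀ hN0]
    calc P ≤ 256 * x := hPhi
      _ = 256 * x ^ (1 - η) * x ^ η := by
          rw [mul_assoc, ← Real.rpow_add hx0]; norm_num
      _ ≤ 256 * x ^ (1 - η) * N := by gcongr
  have hmB : ∀ m ∈ BFI.dyadic M, M < m ∧ (m : ℝ) ≤ 2 * M ∧ 1 ≤ m := fun m hm =>
    mem_dyadic_bounds hM0.le hm
  have hnC : ∀ n ∈ BFI.dyadic N, N < n ∧ (n : ℝ) ≤ 2 * N ∧ 1 ≤ n := fun n hn =>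
    mem_dyadic_bounds hN0.le hn
  have hkbox : ∀ m ∈ BFI.dyadic M, ∀ n ∈ BFI.dyadic N,
      P < ((m * n : ℕ) : ℝ) ∧ ((m * n : ℕ) : ℝ) ≤ 4 * P := by
    intro m hm n hn
    obtain ⟨hm1, hm2, -⟩ := hmB m hm
    obtain ⟨hn1, hn2, -⟩ := hnC n hn
    have hm0 : (0 : ℝ) < m := hM0.trans hm1
    have hn0 : (0 : ℝ) ≤ n := Nat.cast_nonneg _
    push_cast
    rw [hP]
    constructor
    · calc M * N < m * N := mul_lt_mul_of_pos_right hm1 hN0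
        _ < m * n := mul_lt_mul_of_pos_left hn1 hm0
    · calc (m : ℝ) * n ≤ (2 * M) * (2 * N) := mul_le_mul hm2 hn2 hn0 (by linarith)
        _ = 4 * (M * N) := by ring
  -- clipping of the window to `[P/2, 4P]`
  obtain ⟨Ylo', hYlo'⟩ : ∃ Ylo' : ℝ, Ylo' = max Ylo (P / 2) := ⟨_, rfl⟩
  obtain ⟨Yhi', hYhi'⟩ : ∃ Yhi' : ℝ, Yhi' = min Yhi (4 * P) := ⟨_, rfl⟩
  have hYlo'1 : 1 ≤ Ylo' := by rw [hYlo']; exact le_trans (by linarith) (le_max_right _ _)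
  have hYlo'P : P / 2 ≤ Ylo' := by rw [hYlo']; exact le_max_right _ _
  have hYhi'P : Yhi' ≤ 4 * P := by rw [hYhi']; exact min_le_right _ _
  have hwin_iff : ∀ {k : ℝ}, P < k → k ≤ 4 * P →
      ((Ylo' < k ∧ k ≤ Yhi') ↔ (Ylo < k ∧ k ≤ Yhi)) := by
    intro k hk1 hk2
    rw [hYlo', hYhi', max_lt_iff, le_min_iff]
    constructor
    · rintro ⟨⟨h1, -⟩, h2, -⟩; exact ⟨h1, h2⟩
    · rintro ⟨h1, h2⟩; exact ⟨⟨h1, by linarith⟩, h2, hk2⟩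
  -- the weights `F` without the window
  obtain ⟨F, hF⟩ : ∃ F : ℕ → ℕ → ℕ → ℕ → ℕ → ℂ, F = fun q r s m n =>
      if ((m * n : ℕ) : ZMod r) = ((u r : ℤ) : ZMod r) ∧ ((m * n : ℕ) : ZMod q) = ((v q : ℤ) : ZMod q)
      then α m * β n * uR Rd s (((m * n : ℕ) : ZMod s) * ((c : ZMod s))⁻¹) else 0 := ⟨_, rfl⟩
  have hsummand : ∀ q r s : ℕ, ∀ m ∈ BFI.dyadic M, ∀ n ∈ BFI.dyadic N,
      (if Ylo < ((m * n : ℕ) : ℝ) ∧ ((m * n : ℕ) : ℝ) ≤ Yhi ∧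
          ((m * n : ℕ) : ZMod r) = ((u r : ℤ) : ZMod r) ∧
          ((m * n : ℕ) : ZMod q) = ((v q : ℤ) : ZMod q) then
        α m * β n * uR Rd s (((m * n : ℕ) : ZMod s) * ((c : ZMod s))⁻¹) else 0) =
      (if Ylo' < ((m * n : ℕ) : ℝ) ∧ ((m * n : ℕ) : ℝ) ≤ Yhi' then F q r s m n else 0) := by
    intro q r s m hm n hn
    obtain ⟨hk1, hk2⟩ := hkbox m hm n hn
    have hiff := hwin_iff hk1 hk2
    rw [hF]
    simp only
    by_cases hw : Ylo < ((m * n : ℕ) : ℝ) ∧ ((m * n : ℕ) : ℝ) ≤ Yhi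
    · rw [if_pos (hiff.mpr hw)]
      by_cases hA : ((m * n : ℕ) : ZMod r) = ((u r : ℤ) : ZMod r) ∧
          ((m * n : ℕ) : ZMod q) = ((v q : ℤ) : ZMod q)
      · rw [if_pos ⟨hw.1, hw.2, hA⟩, if_pos hA]
      · rw [if_neg (fun h => hA h.2.2), if_neg hA]
    · rw [if_neg (fun h => hw ⟨h.1, h.2.1⟩), if_neg (fun h => hw (hiff.mp h))]
  have hLHS : (∑ q ∈ Icc 1 ⌊x ^ ρ⌋₊, ∑ r ∈ Icc 1 ⌊R⌋₊,
      ‖∑ s ∈ sRange c q r Slo (2 * Slo), ∑ m ∈ BFI.dyadic M, ∑ n ∈ BFI.dyadic N,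
        if Ylo < ((m * n : ℕ) : ℝ) ∧ ((m * n : ℕ) : ℝ) ≤ Yhi ∧
            ((m * n : ℕ) : ZMod r) = ((u r : ℤ) : ZMod r) ∧
            ((m * n : ℕ) : ZMod q) = ((v q : ℤ) : ZMod q) then
          α m * β n * uR Rd s (((m * n : ℕ) : ZMod s) * ((c : ZMod s))⁻¹) else 0‖) =
      ∑ q ∈ Icc 1 ⌊x ^ ρ⌋₊, ∑ r ∈ Icc 1 ⌊R⌋₊,
        ‖∑ s ∈ sRange c q r Slo (2 * Slo), ∑ m ∈ BFI.dyadic M, ∑ n ∈ BFI.dyadic N,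
          if Ylo' < ((m * n : ℕ) : ℝ) ∧ ((m * n : ℕ) : ℝ) ≤ Yhi' then F q r s m n else 0‖ := by
    refine sum_congr rfl fun q _ => sum_congr rfl fun r _ => ?_
    congr 1
    exact sum_congr rfl fun s _ => sum_congr rfl fun m hm => sum_congr rfl fun n hn =>
      hsummand q r s m hm n hn
  rw [hLHS]
  -- degenerate case: empty window
  rcases lt_or_ge Yhi' Ylo' with hemp | hwin
  · have hzero : ∀ q r s : ℕ, ∀ m ∈ BFI.dyadic M, ∀ n ∈ BFI.dyadic N,
        (if Ylo' < ((m * n : ℕ) : ℝ) ∧ ((m * n : ℕ) : ℝ) ≤ Yhi' then F q r s m n else 0) = 0 := by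
      intro q r s m _ n _
      rw [if_neg]
      rintro ⟨h1, h2⟩
      linarith
    have : ∀ q r : ℕ, (∑ s ∈ sRange c q r Slo (2 * Slo), ∑ m ∈ BFI.dyadic M, ∑ n ∈ BFI.dyadic N,
        if Ylo' < ((m * n : ℕ) : ℝ) ∧ ((m * n : ℕ) : ℝ) ≤ Yhi' then F q r s m n else 0) = 0 := by
      intro q r
      exact sum_eq_zero fun s _ => sum_eq_zero fun m hm => sum_eq_zero fun n hn => hzero q r s m hm n hn
    simp only [this, norm_zero, sum_const_zero]
    exact hRHS0
  -- the parameters of the smoothing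
  obtain ⟨V, hV⟩ : ∃ V : ℝ, V = 4 * Real.log x := ⟨_, rfl⟩
  have hV0 : 0 < V := by rw [hV]; linarith
  have hexpV : Real.exp (V / 2) = x ^ (2 : ℝ) := by
    rw [Real.rpow_def_of_pos hx0, hV]; congr 1; ring
  have hx2 : 1024 * x ≤ x ^ (2 : ℝ) := by
    rw [Real.rpow_two, sq]; exact mul_le_mul_of_nonneg_right hx1024 hx0.le
  obtain ⟨δ, hδ⟩ : ∃ δ : ℝ, δ = x ^ (-(4 * ρ₁)) := ⟨_, rfl⟩
  have hδpos : 0 < δ := by rw [hδ]; exact Real.rpow_pos_of_pos hx0 _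
  have hδV1 : δ * V ≤ 1 := by rw [hV]; exact (window_delta_le hx0 hδ hlog4 hlog0).1
  have hδV0 : 0 ≤ δ * V := by positivity
  have hδ4 : δ ≤ 1 / 4 := (window_delta_le hx0 hδ hlog4 hlog0).2
  obtain ⟨H, hH⟩ : ∃ H : ℕ, H = ⌊x ^ (8 * ρ₁)⌋₊ := ⟨_, rfl⟩
  have hH1 : x ^ (8 * ρ₁) ≤ (H : ℝ) + 1 := by rw [hH]; exact (Nat.lt_floor_add_one _).le
  have hYhi'V : Yhi' ≤ Real.exp (V / 2) := by
    rw [hexpV]; linarith only [hYhi'P, hPhi, hx2]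
  have hB1 : ∀ m ∈ BFI.dyadic M, 1 ≤ m := fun m hm => (hmB m hm).2.2
  have hC1 : ∀ n ∈ BFI.dyadic N, 1 ≤ n := fun n hn => (hnC n hn).2.2
  have hBC : ∀ m ∈ BFI.dyadic M, ∀ n ∈ BFI.dyadic N, ((m * n : ℕ) : ℝ) ≤ Real.exp (V / 2) := by
    intro m hm n hn
    rw [hexpV]
    linarith only [(hkbox m hm n hn).2, hPhi, hx2]
  -- (A) the twisted sums: `DilatedTypeIICore` with the coefficients `α_m m^{iτ}`, `β_n n^{iτ}`
  have hMNρ₀ : x ^ (1 - ρ₀) ≤ M * N :=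
    le_trans (Real.rpow_le_rpow_of_exponent_le hx1.le (by linarith)) hMN
  have hSloρ₀ : x ^ (1 / 2 - ρ₀) ≤ Slo :=
    le_trans (Real.rpow_le_rpow_of_exponent_le hx1.le (by linarith)) hSlo
  have hRdρ₀ : Rd ≤ x ^ ρ₀ := hRdx.trans (Real.rpow_le_rpow_of_exponent_le hx1.le hρ₁ρ₀)
  have hBd : ∀ τ : ℝ, (∑ q ∈ Icc 1 ⌊x ^ ρ⌋₊, ∑ r ∈ Icc 1 ⌊R⌋₊,
      ‖∑ s ∈ sRange c q r Slo (2 * Slo), ∑ m ∈ BFI.dyadic M, ∑ n ∈ BFI.dyadic N,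
        (m : ℂ) ^ ((τ : ℂ) * Complex.I) * (n : ℂ) ^ ((τ : ℂ) * Complex.I) * F q r s m n‖) ≤
      C₁' * x ^ (1 + 4 * ρ) / Rd := by
    intro τ
    have hα' : ∀ m, ‖α m * (m : ℂ) ^ ((τ : ℂ) * Complex.I)‖ ≤ ((σ 0 m : ℕ) : ℝ) ^ K := fun m =>
      (norm_mul_cpow_le (α m) m τ).trans (hα m)
    have hβ' : ∀ n, ‖β n * (n : ℂ) ^ ((τ : ℂ) * Complex.I)‖ ≤ ((σ 0 n : ℕ) : ℝ) ^ K := fun n =>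
      (norm_mul_cpow_le (β n) n τ).trans (hβ n)
    have hc₁ := h₁ x hxx₁ M N hN hN' hMNρ₀ hMN' (fun m => α m * (m : ℂ) ^ ((τ : ℂ) * Complex.I))
      (fun n => β n * (n : ℂ) ^ ((τ : ℂ) * Complex.I)) hα' hβ' u v R Slo Rd hR hSloρ₀ hSloR hRd1 hRdρ₀
    have heq : ∀ q r s m n : ℕ,
        (m : ℂ) ^ ((τ : ℂ) * Complex.I) * (n : ℂ) ^ ((τ : ℂ) * Complex.I) * F q r s m n =
        (if ((m * n : ℕ) : ZMod r) = ((u r : ℤ) : ZMod r) ∧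
            ((m * n : ℕ) : ZMod q) = ((v q : ℤ) : ZMod q) then
          (α m * (m : ℂ) ^ ((τ : ℂ) * Complex.I)) * (β n * (n : ℂ) ^ ((τ : ℂ) * Complex.I)) *
            uR Rd s (((m * n : ℕ) : ZMod s) * ((c : ZMod s))⁻¹) else 0) := by
      intro q r s m n
      rw [hF]
      simp only
      split_ifs
      · ring
      · rw [mul_zero]
    simp only [heq]
    refine hc₁.trans ?_
    gcongr
  -- (B) the trivial bound for `∑_s |F|`
  obtain ⟨A, hA⟩ : ∃ A : ℝ, A = Ca ^ K * (512 * x) ^ ε := ⟨_, rfl⟩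
  have hA0 : 0 ≤ A := by rw [hA]; positivity
  obtain ⟨T, hT⟩ : ∃ T : ℝ, T = Cd * x ^ ε := ⟨_, rfl⟩
  obtain ⟨U, hU⟩ : ∃ U : ℝ, U = Cd * (1025 * x) ^ ε + 2 * Rd * T ^ 2 := ⟨_, rfl⟩
  have hU0 : 0 ≤ U := by rw [hU, hT]; positivity
  have hSlo0 : 0 < Slo := lt_of_lt_of_le (Real.rpow_pos_of_pos hx0 _) hSlo
  have hSlo1 : 2 * Slo ≤ x := by
    have h1 : 2 * Slo ≤ 2 * Slo * R := le_mul_of_one_le_right (by positivity) hR1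
    refine h1.trans (hSloR.trans ?_)
    calc x ^ (1 / 2 + ρ) ≤ x ^ (1 : ℝ) :=
          Real.rpow_le_rpow_of_exponent_le hx1.le (by linarith only [hρρ₁, hρ₁s])
      _ = x := Real.rpow_one x
  have hαA : ∀ m ∈ BFI.dyadic M, ‖α m‖ ≤ A := by
    intro m hm
    obtain ⟨-, hm2, hm1⟩ := hmB m hm
    rw [hA]
    exact norm_le_of_divisor_bound hCa1 hK hε.le hCa hm1 (hα m) (by linarith only [hm2, hMx])
  have hβA : ∀ n ∈ BFI.dyadic N, ‖β n‖ ≤ A := by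
    intro n hn
    obtain ⟨-, hn2, hn1⟩ := hnC n hn
    rw [hA]
    refine norm_le_of_divisor_bound hCa1 hK hε.le hCa hn1 (hβ n) ?_
    have : N ≤ x := by
      refine hN'.trans ?_
      calc x ^ (1 / 3 - η) ≤ x ^ (1 : ℝ) :=
            Real.rpow_le_rpow_of_exponent_le hx1.le (by linarith only [hη])
        _ = x := Real.rpow_one x
    linarith only [this, hn2, hx0]
  have hG : ∀ q ∈ Icc 1 ⌊x ^ ρ⌋₊, ∀ r ∈ Icc 1 ⌊R⌋₊, ∀ m ∈ BFI.dyadic M, ∀ n ∈ BFI.dyadic N,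
      (∑ s ∈ sRange c q r Slo (2 * Slo), ‖F q r s m n‖) ≤ A ^ 2 * U := by
    intro q _ r _ m hm n hn
    -- `|F| ≤ A² |uR|`
    have hFle : ∀ s, ‖F q r s m n‖ ≤
        A ^ 2 * ‖uR Rd s ((((m * n : ℕ) : ℤ) : ZMod s) * ((c : ZMod s))⁻¹)‖ := by
      intro s
      rw [hF]
      simp only [Int.cast_natCast]
      split_ifs
      · rw [norm_mul, norm_mul, sq]
        gcongr
        · exact hαA m hm
        · exact hβA n hn
      · rw [norm_zero]; positivity
    refine (sum_le_sum fun s _ => hFle s).trans ?_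
    rw [← mul_sum]
    refine mul_le_mul_of_nonneg_left ?_ (sq_nonneg _)
    -- the `s`-sum of `|uR|`
    have hk : 1 ≤ ((m * n : ℕ) : ℤ) - c := by
      have h1 := (hkbox m hm n hn).1
      have h2 : |(c : ℝ)| + 1 ≤ ((m * n : ℕ) : ℝ) := by linarith only [h1, hP2, hc0]
      have h3 : |c| + 1 ≤ ((m * n : ℕ) : ℤ) := by exact_mod_cast h2
      linarith only [h3, le_abs_self c]
    have hTs : ∀ s ∈ sRange c q r Slo (2 * Slo), ((Nat.divisors s).card : ℝ) ≤ T := by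
      intro s hs
      simp only [sRange, mem_filter, mem_Icc] at hs
      have hs2 : (s : ℝ) ≤ 2 * Slo := by
        have := Nat.floor_le (show 0 ≤ 2 * Slo by linarith)
        exact le_trans (by exact_mod_cast hs.1.2) this
      rw [hT]
      refine (hCd s).trans (mul_le_mul_of_nonneg_left ?_ (by linarith only [hCd1]))
      exact Real.rpow_le_rpow (Nat.cast_nonneg _) (hs2.trans hSlo1) hε.le
    have hSsub : sRange c q r Slo (2 * Slo) ⊆ Icc 1 ⌊2 * Slo⌋₊ := filter_subset _ _
    have hSmem : ∀ s ∈ sRange c q r Slo (2 * Slo), Slo < (s : ℝ) ∧ IsCoprime (s : ℤ) c := by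
      intro s hs
      simp only [sRange, mem_filter] at hs
      exact ⟨hs.2.1, hs.2.2.2⟩
    refine (sum_norm_uR_le c _ hSlo0 hRd0.le hSsub hSmem hTs hk).trans ?_
    rw [hU]
    refine add_le_add ?_ le_rfl
    refine (hCd _).trans (mul_le_mul_of_nonneg_left ?_ (by linarith only [hCd1]))
    refine Real.rpow_le_rpow (Nat.cast_nonneg _) ?_ hε.le
    have h2 := (hkbox m hm n hn).2
    have hkc : (((((m * n : ℕ) : ℤ) - c).toNat : ℕ) : ℝ) = ((m * n : ℕ) : ℝ) - c := by
      have : (((((m * n : ℕ) : ℤ) - c).toNat : ℕ) : ℤ) = ((m * n : ℕ) : ℤ) - c :=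
        Int.toNat_of_nonneg (by linarith only [hk])
      exact_mod_cast congrArg (fun z : ℤ => (z : ℝ)) this
    rw [hkc]
    have : -(c : ℝ) ≤ |(c : ℝ)| := neg_le_abs _
    linarith only [this, h2, hPhi, hxc']
  -- (C) the separation lemma
  have htool := Literature.NumberTheory.Sieve.LogWindow.sum_sum_norm_windowed_le
    (Icc 1 ⌊x ^ ρ⌋₊) (Icc 1 ⌊R⌋₊) (fun q r => sRange c q r Slo (2 * Slo)) (BFI.dyadic M) (BFI.dyadic N)
    F hV0 H hδpos hδ4 hYlo'1 hwin hYhi'V hB1 hC1 hBC hBd hG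
  refine htool.trans ?_
  clear htool hBd hG h₁ hcore hCore hα hβ hsummand hwin_iff
  -- (D) numerics (the analytic inequalities are the `window_*` lemmas above; below, every
  -- monotonicity step is an explicit lemma: blind unification against the cardinalities of the
  -- dyadic boxes is expensive)
  have hlogx0 : 0 < Real.log x := by linarith only [hlog0]
  have hYlo'0 : 0 ≤ Ylo' := by linarith only [hYlo'1]
  have hYhi'0 : 0 ≤ Yhi' := hYlo'0.trans hwin
  have hδ0 : 0 ≤ δ := hδpos.le
  have hxδ0 : 0 < x ^ (1 - 4 * ρ₁) := Real.rpow_pos_of_pos hx0 _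
  have hεfar : 1 / (2 * ((H : ℝ) + 1) * δ) ≤ δ / 2 := window_far_error_le hx0 hδ hH1
  have hbr2 : (δ / 2) * (3 * M) * (3 * N) + (72 * (δ * V) * P + 6 * M) ≤
      83456 * (x ^ (1 - 4 * ρ₁) * Real.log x) := by
    rw [hV]; exact window_bracket_le hx1 hP hPhi hMη hρ₁η hδ hlog0
  have hAU : A ^ 2 * U ≤ 3 * 1025 * (Ca ^ K) ^ 2 * Cd ^ 2 * (Rd * x ^ ρ₁) :=
    window_G_le hx1 hε hεdef hρ₁s hCd1 hRd1 hA hT hU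
  have hlogH : 2 + Real.log ((H : ℝ) + 1) ≤ x ^ ρ :=
    window_log_price_le hx1 hH hρ₁pos hρ₁s hlog0 hlogρ
  have hpart1 : (2 + Real.log ((H : ℝ) + 1)) * (C₁' * x ^ (1 + 4 * ρ) / Rd) ≤
      C₁' * x ^ (1 + 5 * ρ) / Rd := window_main_part_le hx0 hC₁'0 hRd0 hlogH
  have hfinal : Rd * x ^ ρ₁ * (x ^ ρ * x ^ ρ) * (x ^ (1 - 4 * ρ₁) * Real.log x) ≤
      x ^ (1 + 5 * ρ) / Rd := window_power_bookkeeping hx1 hρ hRd0 hRdx hlog1 hlog0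
  -- the strips and the final assembly (cardinalities enter only here)
  have hQc : (#(Icc 1 ⌊x ^ ρ⌋₊) : ℝ) ≤ x ^ ρ := card_Icc_one_floor_le hxρ0
  have hRc : (#(Icc 1 ⌊R⌋₊) : ℝ) ≤ x ^ ρ := (card_Icc_one_floor_le (by linarith only [hR1])).trans hR
  have hBc : (#(BFI.dyadic M) : ℝ) ≤ 3 * M := card_dyadic_le_three_mul hM1
  have hCc : (#(BFI.dyadic N) : ℝ) ≤ 3 * N := card_dyadic_le_three_mul hN1
  have hS2 : (∑ m ∈ BFI.dyadic M, (3 * (δ * V) * (Ylo' + Yhi') / m + 2)) ≤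
      72 * (δ * V) * P + 6 * M := by
    have hW : 0 ≤ 3 * (δ * V) * (Ylo' + Yhi') :=
      mul_nonneg (mul_nonneg (by norm_num) hδV0) (add_nonneg hYlo'0 hYhi'0)
    refine (sum_dyadic_div_add_two_le hM1 hW).trans ?_
    have : 3 * M * (3 * (δ * V) * (Ylo' + Yhi') / M + 2) = 9 * (δ * V) * (Ylo' + Yhi') + 6 * M := by
      field_simp
      ring
    rw [this]
    have hY8 : Ylo' + Yhi' ≤ 8 * P := by linarith only [hwin, hYhi'P]
    have : 9 * (δ * V) * (Ylo' + Yhi') ≤ 9 * (δ * V) * (8 * P) :=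
      mul_le_mul_of_nonneg_left hY8 (mul_nonneg (by norm_num) hδV0)
    linarith only [this]
  have hrows := fun (m : ℕ) (hm : m ∈ BFI.dyadic M) =>
    Literature.NumberTheory.Sieve.LogWindow.card_filter_strip_le (BFI.dyadic N) (hB1 m hm)
      hYlo'0 hYhi'0 hδV0 hδV1
  have hS1 := Finset.sum_le_sum hrows
  have hbr1 : 1 / (2 * ((H : ℝ) + 1) * δ) * #(BFI.dyadic M) * #(BFI.dyadic N) ≤
      (δ / 2) * (3 * M) * (3 * N) :=
    mul_le_mul (mul_le_mul hεfar hBc (Nat.cast_nonneg _) (div_nonneg hδ0 zero_le_two)) hCc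
      (Nat.cast_nonneg _) (mul_nonneg (div_nonneg hδ0 zero_le_two) (by linarith only [hM0]))
  have hbr := (add_le_add hbr1 (hS1.trans hS2)).trans hbr2
  have hG0 : 0 ≤ A ^ 2 * U := mul_nonneg (sq_nonneg _) hU0
  have hQR : (#(Icc 1 ⌊x ^ ρ⌋₊) : ℝ) * #(Icc 1 ⌊R⌋₊) ≤ x ^ ρ * x ^ ρ :=
    mul_le_mul hQc hRc (Nat.cast_nonneg _) hxρ0
  have hQR0 : 0 ≤ (#(Icc 1 ⌊x ^ ρ⌋₊) : ℝ) * #(Icc 1 ⌊R⌋₊) :=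
    mul_nonneg (Nat.cast_nonneg _) (Nat.cast_nonneg _)
  have hGQR0 : 0 ≤ A ^ 2 * U * ((#(Icc 1 ⌊x ^ ρ⌋₊) : ℝ) * #(Icc 1 ⌊R⌋₊)) := mul_nonneg hG0 hQR0
  have hbr0 : 0 ≤ 83456 * (x ^ (1 - 4 * ρ₁) * Real.log x) :=
    mul_nonneg (by norm_num) (mul_nonneg hxδ0.le hlogx0.le)
  have hK0 : 0 ≤ 3 * 1025 * (Ca ^ K) ^ 2 * Cd ^ 2 * (Rd * x ^ ρ₁) :=
    mul_nonneg (mul_nonneg (mul_nonneg (by norm_num) (sq_nonneg _)) (sq_nonneg _))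
      (mul_nonneg hRd0.le (Real.rpow_nonneg hx0.le ρ₁))
  have hpart2 := calc
    A ^ 2 * U * ((#(Icc 1 ⌊x ^ ρ⌋₊) : ℝ) * #(Icc 1 ⌊R⌋₊)) * (83456 * (x ^ (1 - 4 * ρ₁) * Real.log x))
        ≤ (3 * 1025 * (Ca ^ K) ^ 2 * Cd ^ 2 * (Rd * x ^ ρ₁)) * (x ^ ρ * x ^ ρ) *
            (83456 * (x ^ (1 - 4 * ρ₁) * Real.log x)) :=
          mul_le_mul_of_nonneg_right (mul_le_mul hAU hQR hQR0 hK0) hbr0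
    _ = Kc * (Rd * x ^ ρ₁ * (x ^ ρ * x ^ ρ) * (x ^ (1 - 4 * ρ₁) * Real.log x)) := by rw [hKc]; ring
    _ ≤ Kc * (x ^ (1 + 5 * ρ) / Rd) := mul_le_mul_of_nonneg_left hfinal hKc0
    _ = Kc * x ^ (1 + 5 * ρ) / Rd := by ring
  calc _ ≤ C₁' * x ^ (1 + 5 * ρ) / Rd +
        A ^ 2 * U * ((#(Icc 1 ⌊x ^ ρ⌋₊) : ℝ) * #(Icc 1 ⌊R⌋₊)) *
          (83456 * (x ^ (1 - 4 * ρ₁) * Real.log x)) :=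
        add_le_add hpart1 (mul_le_mul_of_nonneg_left hbr hGQR0)
    _ ≤ C₁' * x ^ (1 + 5 * ρ) / Rd + Kc * x ^ (1 + 5 * ρ) / Rd := add_le_add le_rfl hpart2
    _ = (C₁' + Kc) * x ^ (1 + 5 * ρ) / Rd := by ring

end Summit.Parity.GeneralizedHardyLittlewood.Cruxes.TypeI2Dilated.PeelToDrappeau

end
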